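import Summits.QuantumAdvantage.QuantumAdvantage.Theorems.SosSandwichTransferPBNodePromiseBQP
import Summits.QuantumAdvantage.QuantumAdvantage.Theorems.SosSandwichTransferPBEventOSMFinal
import HarnessLib

/-!
# Crux `TransferPB` (stmt-QuantumAdvantage-15238, route SosSandwich), line `birth` — stub `stub_pbOracleSimulation` PROVED

The registered stub `Sig.stub_pbOracleSimulation` (`Theorems/SosSandwichTransferPBDefs.lean`:
`Sig.stub_oracleAcceptPseudoBounded → PseudoBoundedAA → OracleSimulation`, Aaronson–Ambainis 2014 Thm 23 relative to a
promise-`BQP` oracle UNDER PB-AA) follows from its two halves, both tree theorems: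

* the MACHINE half `EvOSM.stub_pbOracleSimulation_of_Q` (`Theorems/SosSandwichTransferPBEventOSMFinal.lean`): the stub follows
  from (Q) `∀ c k F uniform r, nodeProblem F r c k ∈ PromiseBQP` — the reduction stack (robust Thm 21 greedy under PB-AA on
  restrictions of acceptance polynomials, `4T`-wise independent hashing, BBBV heavy-prefix descent as an event-driven
  polynomial-time transcript machine with the combined oracle);
* the QUANTUM half `nodeProblem_mem_PromiseBQP` (`Theorems/SosSandwichTransferPBNodePromiseBQP.lean`): the BLOCK / SINGLE / MEAN
  node tests are in `PromiseBQP` (keyed truncated-runs estimator on the layout with copies, oracle `keyedLang F ∈ P` removed,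
  block statistic read-out).

Deciding theorem of this file: **`stub_pbOracleSimulation : Sig.stub_pbOracleSimulation`** (verbatim the registered signature).
No named fact; axioms standard. Sources: S. Aaronson, A. Ambainis, Theory Comput. 10 (2014), Thm. 21, Thm. 23; M. Zhandry,
CRYPTO 2012, Thm. 3.1; C. H. Bennett, E. Bernstein, G. Brassard, U. Vazirani, SIAM J. Comput. 26 (1997), Cor. 3.4, Thm. 4.14, Cor. 4.15.
-/

-- D-0017: single-conjunct summit ⇒ the duplicate `QuantumAdvantage.QuantumAdvantage` is mandated.
set_option linter.dupNamespace false

noncomputable section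

namespace Summit.QuantumAdvantage.QuantumAdvantage.Cruxes.TransferPB.Birth

open Literature.Computability.Cryptography

/-- **Stub `stub_pbOracleSimulation` of the line `birth` of crux `TransferPB`** (registered signature
`Sig.stub_pbOracleSimulation`): Aaronson–Ambainis Thm 23 relative to a promise-`BQP` oracle, under PB-AA — the machine half
`EvOSM.stub_pbOracleSimulation_of_Q` fed with the quantum half `nodeProblem_mem_PromiseBQP`.
[cite: AaronsonAmbainis2014, Thm. 23 (proof, p. 14)] -/
theorem stub_pbOracleSimulation : Sig.stub_pbOracleSimulation :=
  SimTreePB.EvOSM.stub_pbOracleSimulation_of_Q fun c k _ hF r => SimTreePB.nodeProblem_mem_PromiseBQP r c k hF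

end Summit.QuantumAdvantage.QuantumAdvantage.Cruxes.TransferPB.Birth

end
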